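import Literature.NumberTheory.LFunctions.FordProgram1
import HarnessLib

/-!
# Ford's "Program 1": kernel run 12C (`639 ≤ k ≤ 646`)

Topic `Literature/NumberTheory/LFunctions`. Everything here is PROVED (kernel evaluations, standard
axioms): `FordP1.checkT k = true` for `639 ≤ k ≤ 646`, i.e. the certified re-run of PROGRAM 1 of
K. Ford, Proc. LMS 85 (2002) (the second part of Theorem 3) for these `k` — see `FordProgram1.lean`
for the checker, its soundness `FordP1.row_of_checkK`, and the meaning of the constants
(`ρ = FordP1.rhoOf k / 10⁵`, `θ = FordP1.thetaOf k / 10⁴`, `ω = FordP1.omOf k / 10⁴`). One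
`decide +kernel` per `k` (so that the kernel's evaluation state is bounded by a single run;
`maxHeartbeats 0` lifts the deterministic time-out for each), then the range statement
`FordP1.run12C`. The assembly is `FordTheorem3SmallK.lean`.

## References

* K. Ford, Proc. London Math. Soc. (3) 85 (2002), 565–633; arXiv:1910.08209: Theorem 3, (1.7),
  Lemmas 3.4–3.5, Appendix "PROGRAM 1". [Ford2002]
-/

namespace Literature.NumberTheory.LFunctions
namespace FordP1

set_option maxHeartbeats 0 in
/-- `checkT 639`. [cite: Ford2002, Theorem 3 (second part) and PROGRAM 1] -/
theorem checkT_639 : checkT 639 = true := by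
  decide +kernel

set_option maxHeartbeats 0 in
/-- `checkT 640`. [cite: Ford2002, Theorem 3 (second part) and PROGRAM 1] -/
theorem checkT_640 : checkT 640 = true := by
  decide +kernel

set_option maxHeartbeats 0 in
/-- `checkT 641`. [cite: Ford2002, Theorem 3 (second part) and PROGRAM 1] -/
theorem checkT_641 : checkT 641 = true := by
  decide +kernel

set_option maxHeartbeats 0 in
/-- `checkT 642`. [cite: Ford2002, Theorem 3 (second part) and PROGRAM 1] -/
theorem checkT_642 : checkT 642 = true := by
  decide +kernel

set_option maxHeartbeats 0 in
/-- `checkT 643`. [cite: Ford2002, Theorem 3 (second part) and PROGRAM 1] -/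
theorem checkT_643 : checkT 643 = true := by
  decide +kernel

set_option maxHeartbeats 0 in
/-- `checkT 644`. [cite: Ford2002, Theorem 3 (second part) and PROGRAM 1] -/
theorem checkT_644 : checkT 644 = true := by
  decide +kernel

set_option maxHeartbeats 0 in
/-- `checkT 645`. [cite: Ford2002, Theorem 3 (second part) and PROGRAM 1] -/
theorem checkT_645 : checkT 645 = true := by
  decide +kernel

set_option maxHeartbeats 0 in
/-- `checkT 646`. [cite: Ford2002, Theorem 3 (second part) and PROGRAM 1] -/
theorem checkT_646 : checkT 646 = true := by
  decide +kernel

/-- **Kernel run 12C**: `checkT k` for `639 ≤ k ≤ 646`. [cite: Ford2002, Theorem 3 (second part)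
and PROGRAM 1] -/
theorem run12C (k : ℕ) (h1 : 639 ≤ k) (h2 : k ≤ 646) : checkT k = true := by
  interval_cases k
  · exact checkT_639
  · exact checkT_640
  · exact checkT_641
  · exact checkT_642
  · exact checkT_643
  · exact checkT_644
  · exact checkT_645
  · exact checkT_646

end FordP1
end Literature.NumberTheory.LFunctions
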